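import Summits.CriticalPhenomena.PercolationContinuityZ3.Theorems.Transplant.SkelWinPackagingO
import Summits.CriticalPhenomena.PercolationContinuityZ3.Theorems.Transplant.SkelWinPackaging
import Summits.CriticalPhenomena.PercolationContinuityZ3.Theorems.Transplant.KNCells2KitAtRunO
import Summits.CriticalPhenomena.PercolationContinuityZ3.Theorems.Transplant.KNCells2KitAtRun
import Summits.CriticalPhenomena.PercolationContinuityZ3.Theorems.Transplant.KNCells2RootChainO
import Summits.CriticalPhenomena.PercolationContinuityZ3.Theorems.Transplant.KNCells2RootChain
import Summits.CriticalPhenomena.PercolationContinuityZ3.Theorems.Transplant.KNCellsSchemeO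
import Summits.CriticalPhenomena.PercolationContinuityZ3.Theorems.Transplant.KNCellsProcessO
import Summits.CriticalPhenomena.PercolationContinuityZ3.Theorems.Transplant.KNCellsRunO
import Summits.CriticalPhenomena.PercolationContinuityZ3.Theorems.Transplant.KNCellsRunInvO
import Summits.CriticalPhenomena.PercolationContinuityZ3.Theorems.Transplant.KNCells2SchemeO
import Summits.CriticalPhenomena.PercolationContinuityZ3.Theorems.Transplant.KNCells2RunO
import Summits.CriticalPhenomena.PercolationContinuityZ3.Theorems.Transplant.KNCells2RunInvO
import Summits.CriticalPhenomena.PercolationContinuityZ3.Theorems.Transplant.KNCellsCoverO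
import Summits.CriticalPhenomena.PercolationContinuityZ3.Theorems.Transplant.KNCells2CoverO
import Summits.CriticalPhenomena.PercolationContinuityZ3.Theorems.Transplant.KNCellsReachO
import Summits.CriticalPhenomena.PercolationContinuityZ3.Theorems.Transplant.KNCells2ReachO
import Summits.CriticalPhenomena.PercolationContinuityZ3.Theorems.Transplant.KNCellsExitO
import Summits.CriticalPhenomena.PercolationContinuityZ3.Theorems.Transplant.KNCells2ExitO
import Summits.CriticalPhenomena.PercolationContinuityZ3.Theorems.Transplant.KNCellsStepsDefsO
import Summits.CriticalPhenomena.PercolationContinuityZ3.Theorems.Transplant.KNCellsStepsReachO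
import Summits.CriticalPhenomena.PercolationContinuityZ3.Theorems.Transplant.KNCellsStepsPinO
import Summits.CriticalPhenomena.PercolationContinuityZ3.Theorems.Transplant.KNCellsStepsSubboxO
import Summits.CriticalPhenomena.PercolationContinuityZ3.Theorems.Transplant.KNCellsStepsChainO
import Summits.CriticalPhenomena.PercolationContinuityZ3.Theorems.Transplant.KNCellsStepsFailO
import Summits.CriticalPhenomena.PercolationContinuityZ3.Theorems.Transplant.KNCells2StepsO
import Summits.CriticalPhenomena.PercolationContinuityZ3.Theorems.Transplant.KNCells2FailO
import Summits.CriticalPhenomena.PercolationContinuityZ3.Theorems.Transplant.KNCells2FacePrefixO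
import Summits.CriticalPhenomena.PercolationContinuityZ3.Theorems.Transplant.KNCells2ThetaPosChosenO
import Summits.CriticalPhenomena.PercolationContinuityZ3.Theorems.Transplant.KNCells2CorridorO
import Summits.CriticalPhenomena.PercolationContinuityZ3.Theorems.Transplant.KNCells2CorridorEdgeO
import Summits.CriticalPhenomena.PercolationContinuityZ3.Theorems.Transplant.SkelKitResidues
import Literature.Probability.Percolation.OrientedHistorySiteRenormalizationRun
import HarnessLib

/-!
# N2 (frames-only node `SamePDropOfSkeletonFrm₁`, OPEN) — ORIENTED MACRO LAYER (WAVE 0 (c1), (R-18) `q ≡ true`): the oriented twin of N1's `SkelKitResidues`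

builds on p205010 (kernel theorem, internal audit signed; external expert review pending) — nothing in this file uses p205010; NOTHING is claimed about the
open node `SamePDropOfSkeletonFrm₁` (`SamePDropOfSkeletonNeg₁` is CLOSED in the tree and untouched by this file).
Status sentence (coordinator 2026-08-20T04:30Z): "θ(p_c) = 0 on ℤ^d, all d ≥ 2 — kernel-verified (Lean 4/Mathlib, standard axioms); internal adversarial
audit SIGNED 2026-08-20 04:29Z; external expert review pending."
Lane `prim-bschramm-*`, seat `prim-bschramm-stmt` (gen 19); helper file (`--supports stmt-CriticalPhenomena-4575 --as helper`); N2-SCOPE §20, (R-18)/(R-19).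
PORT RULES (HOME/prim-bschramm-stmt-g19/lean/port_orient.py): the history-site API is replaced by its ORIENTED twin at the fixed quadrant `qNE := fun _ => true`
(`HState.choice ↦ HState.ochoice qNE`, `mstOf ↦ omstOf qNE`, `mst/stN ↦ omst/ostN qNE`, `occFinal ↦ ooccFinal qNE`, `Lawful ↦ OLawful qNE`, onward directions
`onward ↦ onwardO` = the POSITIVE ones, (N2-e)); every declaration whose text changes thereby — directly or through a changed declaration — is re-declared with the
suffix `O` (same namespace); unchanged declarations of the N1 file are NOT repeated (the N1 module is imported). Docstrings/citations are N1's.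
N1 HEADER (kept for the reader):
* `Skel.RootOblT G S Δ' δr` — per direction a linked chain of window target steps (any window centre / depth) of some length `n + 1` under the root law cut to a sub-world
  `U'`, kits at accuracy `δr n`, rim excess, source bound, last true target in `M_{a₀}(0+du)` (hypotheses of `KSchA.hQ0_of_chain_sub` minus
  `hchain`); `rootObl_of_rootOblT`.
* `Skel.FaceOblAt Φ S FD Δ' δ₂ h e a a' du j o` — `∃ (P : WinStepData V) T' η`: hypotheses of `cond_of_winStep` minus `hstep`, `hsrc`;
  `Skel.FaceOblR` (run histories, chosen edge, onward `du`, `j < K`, `o`, at `(aOf₁, aOf₂)`); `cond_of_faceOblAt`.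
* `Skel.ReachOblAt Φ S FD Δ' δ h e a' du` — `∃ (P : WinChainData V) R₀ η`: hypotheses of `hreach_of_winChain` minus `hchain`, `hδc`;
  `Skel.ReachOblR`; `reach_of_reachOblAt`.
* **`Skel.kitAtRun_of_oblR`** — `δc ≤ δ`, the step / chain properties at `S.p` for ALL window graphs `winGraph G c Rπ` (from `Φ.apply_step_UP` /
  `Φ.chain_edge_UP` of SkelChainUP at `G' := winGraph G c Rπ ≤ G`, `Skel.winGraph_le`), `RootOblT … δr`, `FaceOblR … δ₂`, `ReachOblR … δ` ⟹ `KitAtRun G S FD δ₂ ε''`.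
[cite: KozmaNitzan2024, §4 (30), (32) (pp. 27–28), Lemma 10 (p. 17), Lemmas 11–12 (pp. 22–25), p. 30 (Steps III–IV)]
-/
noncomputable section

open MeasureTheory ProbabilityTheory
open scoped ENNReal Classical

namespace Summit.CriticalPhenomena.PercolationContinuityZ3.Theorems

namespace Transplant

namespace Skel

open Literature.Probability.Percolation Literature.Probability.LatticeModels SimpleGraph KNCells
open GadgetSystem ProbeHistory HSiteScheme Contour

variable {V : Type} [DecidableEq V] [Countable V] {G : SimpleGraph V} [G.LocallyFinite] (Φ : PlanarSkeletonConc G)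
variable {A : Type*}

/-! ## §1 The residues -/

omit Φ in
variable (G) in
/-- **The root obligation in window form** (D8): for every direction `du` a linked chain of `n + 1` target steps in a window graph of some
centre `c` and depth `Rπ` (the (R) port takes `c :=` the root), with common source the root, under the root law cut to a sub-world `U' ⊆ Q_0 ∪ E_{0,du}` containing the root, kits at accuracy
`δr n`, true targets inside the enlarged ones with excess `≤ η ≤ δr n / 2`, the source bound `1 - δr n < P((s 0).reachB)` and the last true
target inside `M_{a₀}(0 + du)` — the hypotheses of `KSchA.hQ0_of_chain_subO` except the chain property.
[cite: KozmaNitzan2024, §4 p. 27 (G₀), p. 28 ((32) at the root), Lemma 12 (pp. 23–25)] -/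
def RootOblTO (S : KSchA V A) (Δ' : ℕ) (δr : ℕ → ℝ) : Prop :=
  ∀ du : MDir, ∃ (n : ℕ) (c : V) (Rπ : ℕ) (U' : Finset V)
    (s : Fin (n + 1) → KNLevels.TStep (winGraph G c Rπ)) (T' : Fin (n + 1) → Finset V) (η : ℝ),
    U' ⊆ S.U0root du ∧ S.Γ.root ∈ U' ∧ (∀ i : Fin (n + 1), (s i).L.o = S.Γ.root) ∧
    (∀ i : Fin n, T' (Fin.castSucc i) ⊆ (s i.succ).L.X 0) ∧ (∀ i : Fin (n + 1), T' i ⊆ (s i).T) ∧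
    (∀ i : Fin (n + 1), (s i).KitsAt (S.W0sub G U') S.p Δ' (δr n)) ∧ η ≤ δr n / 2 ∧
    (∀ i : Fin (n + 1), (prodBernoulli (S.W0sub G U')).real (⋃ t ∈ (s i).T \ T' i, openConn S.Γ.root t) ≤ η) ∧
    1 - δr n < (prodBernoulli (S.W0sub G U')).real (s 0).L.reachB ∧
    T' (Fin.last n) ⊆ S.Γ.M S.Γ.a₀ ((0 : Site 2) + stepVec du)

/-- **The face obligations, run-restricted form**: `FaceOblAt` for every RUN history whose chosen candidate is `e`, valid, every onward direction,
every `j < K` and every `o`, at the history anchors `(aOf₁O, aOf₂O)`. [cite: KozmaNitzan2024, §4 p. 30 (Steps III–IV)] -/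
def FaceOblRO (S : KSchA V A) (FD : FaceData V A) (Δ' : ℕ) (δ₂ : ℝ) : Prop :=
  ∀ h e, S.IsRun₂O G h → (S.astOf₂O G h).st.ochoice KSchA.qNE = some e → S.Valid₂O G h e →
    ∀ du ∈ S.onwardO G h (tgt e), ∀ j < S.Γ.K, ∀ o : Finset (Sym2 V),
      FaceOblAt Φ S FD Δ' δ₂ h e (S.aOf₁O G h e) (S.aOf₂O G h e) du j o

/-- **The corridor obligation at one probe** `(h, e, a', du)`: a window corridor chain `P` rooted (and centred) at the scheme's root with the schedule
arithmetic (`r = 4t`, `100 R' ≤ t`, `Rlev + 1 ≤ R'`), rim parts inside the step regions, nonempty true targets, Step II's count at accuracy `δ`,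
the subbox / support facts of the law `Wcor`, the per-step kit clauses at accuracy `δ`, the rim excess `≤ η ≤ δ/2`, the arrival cube inside
`Win root (C.M x) R₀`, `R₀ ≤ Rπ`, and `Win root (M_y ∩ H_{x,y}) Rπ` inside `M^{a'}_{x+du}` — the hypotheses of `Skel.hreach_of_winChainO` except the
generic chain property and `δc ≤ δ`. [cite: KozmaNitzan2024, §4 Lemma 12 (pp. 23–25), p. 30 (Step IV)] -/
def ReachOblAtO (S : KSchA V A) (FD : FaceData V A) (Δ' : ℕ) (δ : ℝ) (h : ProbeHistory V) (e : Site 2 × MDir) (a' : A) (du : MDir) : Prop :=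
  ∃ (P : WinChainData V) (R₀ : ℕ) (η : ℝ),
    P.root = S.Γ.root ∧ P.C.r = 4 * P.t ∧ 100 * P.R' ≤ P.t ∧ P.Rlev + 1 ≤ P.R' ∧ (∀ i, P.Rim i ⊆ P.stepD Φ i) ∧
    (∀ i ≤ ChainPlanar.Sched.nLast, (P.tgtT Φ i).Nonempty) ∧
    P.j₁ ≤ P.Rlev ∧ 1 / (1 - (S.p : ℝ)) ^ (Δ' * P.N) ≤ δ * ((Finset.Icc P.j₀ P.j₁).card : ℝ) ∧
    (∀ i ≤ ChainPlanar.Sched.nLast,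
      KNLevels.IsSubbox (winGraph G P.root P.Rπ) (S.Wcor G FD h e (S.aOf₁O G h e) a' du) S.p (P.stepD Φ i)) ∧
    KNLevels.FinSupp (S.Wcor G FD h e (S.aOf₁O G h e) a' du) P.Sfin ∧
    (∀ i ≤ ChainPlanar.Sched.nLast, P.stepD Φ i ⊆ P.Sfin) ∧ (∀ i ≤ ChainPlanar.Sched.nLast, P.root ∉ P.stepD Φ i) ∧ P.root ∈ P.Sfin ∧
    (∀ i ≤ ChainPlanar.Sched.nLast, ∀ j ∈ Finset.Icc P.j₀ P.j₁,
      ∃ (σ : KNLevels.SData V) (Sz : Finset V),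
      KNLevels.SHyp (winLData Φ P.root P.Rπ (P.lo i) (P.hi i) P.root P.Sfin) j σ ∧ σ.N ≤ P.N ∧
      (1 - (S.p : ℝ) ^ σ.sB) ^ σ.k ≤ δ ∧ Sz ⊆ (winLData Φ P.root P.Rπ (P.lo i) (P.hi i) P.root P.Sfin).X j ∧ Sz ⊆ P.stepD Φ i ∧
      (∀ x ∈ σ.K, ∀ e' ∈ σ.seed x, e' ∉ wireSet (↑Sz : Set V)) ∧ (∀ x ∈ σ.K, σ.face x ⊆ Sz) ∧
      (∀ x ∈ σ.K, 1 - 3 * δ ≤ (prodBernoulli (S.Wcor G FD h e (S.aOf₁O G h e) a' du)).real {ω | ∃ u ∈ σ.face x,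
        1 - δ < (prodBernoulli (pinW (S.Wcor G FD h e (S.aOf₁O G h e) a' du) (wireSet (↑Sz : Set V)) ω)).real
          (⋃ t ∈ P.tgtE Φ i, openConnIn (↑(P.stepD Φ i) : Set V) u t)})) ∧
    η ≤ δ / 2 ∧
    (∀ i ≤ ChainPlanar.Sched.nLast, (prodBernoulli (S.Wcor G FD h e (S.aOf₁O G h e) a' du)).real
      (⋃ t ∈ P.Rim i, openConn S.Γ.root t) ≤ η) ∧
    R₀ ≤ P.Rπ ∧ S.Γ.M (S.aOf₁O G h e) (tgt e) ⊆ Φ.Win P.root (P.C.M P.x) R₀ ∧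
    Φ.Win P.root (P.C.M (P.x + stepVec P.du) ∩ P.C.Hfull P.x P.du) P.Rπ ⊆ S.Γ.M a' (tgt e + stepVec du)

/-- **The corridor obligations, run-restricted form**: `ReachOblAtO` for every RUN history whose chosen candidate is `e`, valid, and every onward
direction, at `a' = aOf₂O`. [cite: KozmaNitzan2024, §4 p. 30 (Step IV), Lemma 12 (pp. 23–25)] -/
def ReachOblRO (S : KSchA V A) (FD : FaceData V A) (Δ' : ℕ) (δ : ℝ) : Prop :=
  ∀ h e, S.IsRun₂O G h → (S.astOf₂O G h).st.ochoice KSchA.qNE = some e → S.Valid₂O G h e →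
    ∀ du ∈ S.onwardO G h (tgt e), ReachOblAtO Φ S FD Δ' δ h e (S.aOf₂O G h e) du

/-! ## §2 Discharging the three conjuncts of `KitAtRun` from the residues -/

variable {Φ}
variable {S : KSchA V A} {FD : FaceData V A}
variable {h : ProbeHistory V} {e : Site 2 × MDir} {a a' : A} {du : MDir}

omit Φ in
/-- **`RootOblTO` + the chain property of every length at `(δr n ↦ δc)` ⟹ the root conjunct (32) of `KitAtRunO`** (`KSchA.hQ0_of_chain_subO`; the
product's `KSchA.RootObl G S`, stated inline).
[cite: KozmaNitzan2024, §4 p. 28 ((32) at the root), Lemma 12 (pp. 23–25)] -/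
theorem rootObl_of_rootOblTO {Δ' : ℕ} {δr : ℕ → ℝ}
    (hchain : ∀ (n : ℕ) (c : V) (Rπ : ℕ) (Wg : Sym2 V → unitInterval) (s : Fin (n + 1) → KNLevels.TStep (winGraph G c Rπ))
      (T' : Fin (n + 1) → Finset V) (η : ℝ),
      (∀ i : Fin (n + 1), (s i).L.o = (s 0).L.o) →
      (∀ i : Fin n, T' (Fin.castSucc i) ⊆ (s i.succ).L.X 0) →
      (∀ i : Fin (n + 1), T' i ⊆ (s i).T) →
      (∀ i : Fin (n + 1), (s i).KitsAt Wg S.p Δ' (δr n)) →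
      η ≤ δr n / 2 →
      (∀ i : Fin (n + 1), (prodBernoulli Wg).real (⋃ t ∈ (s i).T \ T' i, openConn (s 0).L.o t) ≤ η) →
      1 - δr n < (prodBernoulli Wg).real (s 0).L.reachB →
        1 - S.δc < (prodBernoulli Wg).real (⋃ t ∈ T' (Fin.last n), openConn (s 0).L.o t))
    (hR : RootOblTO G S Δ' δr) :
    ∀ du : MDir, du.2 = KSchA.qNE du.1 → 1 - S.δc < (prodBernoulli (pinW (KNLevels.lattW G S.p) ↑(S.U₀ G) ↑(S.U₀ G))).real
      (⋃ t ∈ (↑(S.Γ.M S.Γ.a₀ ((0 : Site 2) + stepVec du)) : Set V),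
        openConnIn (↑(S.Γ.Q S.Γ.a₀ 0 ∪ S.Γ.Ewv S.Γ.a₀ 0 du) : Set V) S.Γ.root t) := by
  intro du _hdu
  obtain ⟨n, c, Rπ, U', s, T', η, hU', hroot, ho, hlink, hsub, hkits, hη, hexc, hsrc, hTn⟩ := hR du
  exact KSchA.hQ0_of_chain_subO (winGraph G c Rπ) hU' hroot le_rfl (hchain n c Rπ) s T' ho hlink hsub hkits hη hexc hsrc hTn

/-- **`ReachOblAtO` + the chain property at `(δ ↦ ε'')` + `δc ≤ δ` ⟹ the corridor bound `1 - ε'' < P_{Wfull}(Reach)`** (`Skel.hreach_of_winChainO`).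
[cite: KozmaNitzan2024, §4 Lemma 12 (pp. 23–25), p. 30 (Step IV)] -/
theorem reach_of_reachOblAtO (hV : S.Valid₂O G h e) {Δ' : ℕ} {δ ε'' : ℝ} (hδc : S.δc ≤ δ)
    (hchain : ∀ (c : V) (Rπ : ℕ) (Wg : Sym2 V → unitInterval)
      (s : Fin (ChainPlanar.Sched.nLast + 1) → KNLevels.TStep (winGraph G c Rπ))
      (T' : Fin (ChainPlanar.Sched.nLast + 1) → Finset V) (η : ℝ),
      (∀ i, (s i).L.o = (s 0).L.o) →
      (∀ i : Fin ChainPlanar.Sched.nLast, T' (Fin.castSucc i) ⊆ (s i.succ).L.X 0) →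
      (∀ i, T' i ⊆ (s i).T) →
      (∀ i, (s i).KitsAt Wg S.p Δ' δ) →
      η ≤ δ / 2 →
      (∀ i, (prodBernoulli Wg).real (⋃ t ∈ (s i).T \ T' i, openConn (s 0).L.o t) ≤ η) →
      1 - δ < (prodBernoulli Wg).real (s 0).L.reachB →
        1 - ε'' < (prodBernoulli Wg).real (⋃ t ∈ T' (Fin.last ChainPlanar.Sched.nLast), openConn (s 0).L.o t))
    (hR : ReachOblAtO Φ S FD Δ' δ h e a' du) :
    1 - ε'' < (prodBernoulli (S.Wfull G h e (S.aOf₁O G h e) a' du)).real (S.Reach G FD h e (S.aOf₁O G h e) a' du) := by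
  obtain ⟨P, R₀, η, hroot, hr, hR', hRl, hRim, hTne, hj, hcount, hsub, hfin, hDS, ho, hoS, hkits, hη, hexc, hR₀, hM0, hMn⟩ := hR
  exact hreach_of_winChainO Φ P hV hδc (hchain P.root P.Rπ) hroot hr hR' hRl hRim hTne hj hcount hsub hfin hDS ho hoS hkits hη hexc hR₀ hM0
    hMn

/-- **The run-restricted obligations from the named residues**: `δc ≤ δ`, the one-step property at `(δ₂ ↦ δc/2)`, the chain property of length
`nLast + 1` at `(δ ↦ ε'')` and the chain properties of every length at `(δr n ↦ δc)` for all window graphs `winGraph G c Rπ` at the parameter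
`S.p` (U2: `PlanarSkeletonConc.apply_step_UP` / `chain_edge_UP` at `G' := winGraph G c Rπ ≤ G`), `RootOblTO … δr`, `FaceOblRO … δ₂` and `ReachOblRO … δ`
⟹ p5-g3's `KitAtRunO G S FD δ₂ ε''`. [cite: KozmaNitzan2024, §4 (30), (32), Lemmas 10–12] -/
theorem kitAtRun_of_oblRO {Δ' : ℕ} {δ δ₂ ε'' : ℝ} {δr : ℕ → ℝ} (hδc : S.δc ≤ δ)
    (hstep : ∀ (c : V) (Rπ : ℕ) (Wg : Sym2 V → unitInterval) (s : KNLevels.TStep (winGraph G c Rπ)), s.KitsAt Wg S.p Δ' δ₂ →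
      1 - δ₂ < (prodBernoulli Wg).real s.L.reachB → 1 - S.δc / 2 < (prodBernoulli Wg).real (⋃ t ∈ s.T, openConn s.L.o t))
    (hchain : ∀ (c : V) (Rπ : ℕ) (Wg : Sym2 V → unitInterval)
      (s : Fin (ChainPlanar.Sched.nLast + 1) → KNLevels.TStep (winGraph G c Rπ))
      (T' : Fin (ChainPlanar.Sched.nLast + 1) → Finset V) (η : ℝ),
      (∀ i, (s i).L.o = (s 0).L.o) →
      (∀ i : Fin ChainPlanar.Sched.nLast, T' (Fin.castSucc i) ⊆ (s i.succ).L.X 0) →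
      (∀ i, T' i ⊆ (s i).T) →
      (∀ i, (s i).KitsAt Wg S.p Δ' δ) →
      η ≤ δ / 2 →
      (∀ i, (prodBernoulli Wg).real (⋃ t ∈ (s i).T \ T' i, openConn (s 0).L.o t) ≤ η) →
      1 - δ < (prodBernoulli Wg).real (s 0).L.reachB →
        1 - ε'' < (prodBernoulli Wg).real (⋃ t ∈ T' (Fin.last ChainPlanar.Sched.nLast), openConn (s 0).L.o t))
    (hchainr : ∀ (n : ℕ) (c : V) (Rπ : ℕ) (Wg : Sym2 V → unitInterval) (s : Fin (n + 1) → KNLevels.TStep (winGraph G c Rπ))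
      (T' : Fin (n + 1) → Finset V) (η : ℝ),
      (∀ i : Fin (n + 1), (s i).L.o = (s 0).L.o) →
      (∀ i : Fin n, T' (Fin.castSucc i) ⊆ (s i.succ).L.X 0) →
      (∀ i : Fin (n + 1), T' i ⊆ (s i).T) →
      (∀ i : Fin (n + 1), (s i).KitsAt Wg S.p Δ' (δr n)) →
      η ≤ δr n / 2 →
      (∀ i : Fin (n + 1), (prodBernoulli Wg).real (⋃ t ∈ (s i).T \ T' i, openConn (s 0).L.o t) ≤ η) →
      1 - δr n < (prodBernoulli Wg).real (s 0).L.reachB →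
        1 - S.δc < (prodBernoulli Wg).real (⋃ t ∈ T' (Fin.last n), openConn (s 0).L.o t))
    (hQ0 : RootOblTO G S Δ' δr) (hface : FaceOblRO Φ S FD Δ' δ₂) (hreach : ReachOblRO Φ S FD Δ' δ) :
    KSchA.KitAtRunO G S FD δ₂ ε'' := by
  refine And.intro (rootObl_of_rootOblTO hchainr hQ0) (And.intro ?_ ?_)
  · intro h e hrun hc hV du hdu j hj o hsrc
    exact cond_of_faceOblAt hstep (hface h e hrun hc hV du hdu j hj o) hsrc
  · intro h e hrun hc hV du hdu
    exact reach_of_reachOblAtO hV hδc hchain (hreach h e hrun hc hV du hdu)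

end Skel

end Transplant

end Summit.CriticalPhenomena.PercolationContinuityZ3.Theorems

end
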